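import Literature.NumberTheory.K2Lit.DoublingZetaIntegral
import Mathlib.MeasureTheory.Integral.DominatedConvergence
import HarnessLib

/-!
# Residue ↔ pairing exchange: a pointwise limit under a uniform bound passes through the doubling pairing (socket #43)

Track B ∕ hLiu418 = stmt-HodgeConjecture-24832, line `K2_Liu_CurveThetaSigs`, unit U6 «FIRST TERM AT THE TOP POLE» (the s5 seam), organ (F3);
socket #43 `sig_K2LiuResiduePairingExchange` of `Cruxes/HLiu418/Lines/K2_Liu_CurveThetaSigs_U6_FirstTerm.lean` (ED. 1, :152) PAID BY NAME by
`residuePairingExchange` below (statement byte-identical). Seat `hodgecm-mathlib-K2Liu-p03` (g2).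

For ANY adelic group datum `𝒢`, a finite measure `μ` on `[G]`, `φ₁, φ₂ ∈ L²(μ)`, a point `s₀` and a family
`F : ℂ → [G]² → ℂ` which, for `s` in a punctured neighbourhood of `s₀`, is a.e.-strongly measurable and uniformly bounded, and converges pointwise
`F s x → R x` (`s → s₀`, `s ≠ s₀`), the doubling pairing ★ `K2Lit/DoublingZetaIntegral.doublingPairing`
(`= ∫ K x · φ₁ x.1 · conj (φ₂ x.2) d(μ ⊗ μ)`) converges: `doublingPairing μ (F s) φ₁ φ₂ → doublingPairing μ R φ₁ φ₂`.
This is Lebesgue's dominated convergence along the countably generated filter `𝓝[≠] s₀` (Mathlib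
`tendsto_integral_filter_of_dominated_convergence`) with the dominating function `C·|φ₁(x₁)|·|φ₂(x₂)| ∈ L¹(μ ⊗ μ)` (`L² ⊂ L¹` on a finite measure,
`MemLp.integrable`, `Integrable.mul_prod`). In s5 it exchanges `lim_{s → ½} (s−½)·` with the absolutely convergent pairing on the compact `[G]²`
([Liu2021, Lem. B.12]: «taking residue at `s = ½` on both sides of (B.5)»).

* `integrable_const_mul_norm_mul_norm` — `x ↦ C·‖φ₁ x.1‖·‖φ₂ x.2‖` is `μ ⊗ μ`-integrable for `φᵢ ∈ L²(μ)`, `μ` finite.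
* `residuePairingExchange` — socket #43.

No definition, no instance, no named fact; axioms ⊆ {propext, Classical.choice, Quot.sound}.

## References
* Y. Liu, *Fourier–Jacobi cycles and arithmetic relative trace formula*, Camb. J. Math. 9 (2021), Lem. B.12 pp. 103–104 [Liu2021].
* S. Kudla, S. Rallis, *A regularized Siegel–Weil formula: the first term identity*, Ann. of Math. 140 (1994), §1 [KudlaRallis1994].

HONEST LABEL: HC_CM is proved only modulo the 7 printed citations (2 remaining named inputs: hLiu418 =
stmt-HodgeConjecture-24832, h413 = stmt-HodgeConjecture-24833) until rung 0 closes; #43 is a socket of the s5 seam — moves no counter.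
-/

noncomputable section

set_option autoImplicit false

set_option linter.dupNamespace false

open scoped Matrix Topology
open NumberField IsDedekindDomain MeasureTheory Filter

namespace Summit.HodgeConjecture.HodgeConjecture.Cruxes.HLiu418.K2LiuResiduePairingExchange

open Literature.NumberTheory.Automorphic Literature.NumberTheory.GaloisRepresentations
open Literature.NumberTheory.GelbartRogawski1991 Literature.NumberTheory.GelbartRogawski1991.GRConstruction
open Literature.NumberTheory.K2Lit.SiegelDoubled

/-- **The dominating function**: for `φ₁, φ₂ ∈ L²(μ)` on a finite measure space and a constant `C`,
`x ↦ C · (‖φ₁ x.1‖ · ‖φ₂ x.2‖)` is `μ ⊗ μ`-integrable (`L² ⊂ L¹`, Mathlib `MemLp.integrable` + `Integrable.mul_prod`). [folklore] -/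
theorem integrable_const_mul_norm_mul_norm {K : Type} [Field K] [NumberField K] (𝒢 : AdelicGroupData.{0} K)
    (μ : Measure 𝒢.automorphicQuotient) [IsFiniteMeasure μ]
    {φ₁ φ₂ : 𝒢.automorphicQuotient → ℂ} (hφ₁ : MemLp φ₁ 2 μ) (hφ₂ : MemLp φ₂ 2 μ) (C : ℝ) :
    Integrable (fun x : 𝒢.automorphicQuotient × 𝒢.automorphicQuotient => C * (‖φ₁ x.1‖ * ‖φ₂ x.2‖)) (μ.prod μ) := by
  have h1 : Integrable (fun y => ‖φ₁ y‖) μ := (hφ₁.integrable one_le_two).norm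
  have h2 : Integrable (fun y => ‖φ₂ y‖) μ := (hφ₂.integrable one_le_two).norm
  exact (h1.mul_prod h2).const_mul C

/-- **Socket #43 `sig_K2LiuResiduePairingExchange` — RESIDUE ↔ PAIRING EXCHANGE** (statement byte-identical to
`Cruxes/HLiu418/Lines/K2_Liu_CurveThetaSigs_U6_FirstTerm.lean` ED. 1 :152): a pointwise limit `F s x → R x` along `𝓝[≠] s₀` of an eventually
a.e.-strongly measurable, eventually uniformly bounded family passes through the doubling pairing against `φ₁, φ₂ ∈ L²(μ)`, `μ` finite.
Dominated convergence (Mathlib `tendsto_integral_filter_of_dominated_convergence`; `𝓝[≠] s₀` is countably generated) with bound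
`max C 0 · ‖φ₁ x.1‖ · ‖φ₂ x.2‖`. [cite: Liu2021, Lem. B.12 pp. 103–104] [cite: KudlaRallis1994, §1] -/
theorem residuePairingExchange :
    ∀ (K : Type) [Field K] [NumberField K] (𝒢 : AdelicGroupData.{0} K)
      (μ : Measure 𝒢.automorphicQuotient) [IsFiniteMeasure μ]
      (φ₁ φ₂ : 𝒢.automorphicQuotient → ℂ), MemLp φ₁ 2 μ → MemLp φ₂ 2 μ →
      ∀ (s₀ : ℂ) (F : ℂ → 𝒢.automorphicQuotient × 𝒢.automorphicQuotient → ℂ)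
        (R : 𝒢.automorphicQuotient × 𝒢.automorphicQuotient → ℂ),
        (∀ᶠ s in 𝓝[≠] s₀, AEStronglyMeasurable (F s) (μ.prod μ)) →
        (∃ C : ℝ, ∀ᶠ s in 𝓝[≠] s₀, ∀ x, ‖F s x‖ ≤ C) →
        (∀ x, Tendsto (fun s => F s x) (𝓝[≠] s₀) (𝓝 (R x))) →
        Tendsto (fun s => doublingPairing 𝒢 μ (F s) φ₁ φ₂) (𝓝[≠] s₀) (𝓝 (doublingPairing 𝒢 μ R φ₁ φ₂)) := by
  intro K _ _ 𝒢 μ _ φ₁ φ₂ hφ₁ hφ₂ s₀ F R hmeas hbound hlim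
  obtain ⟨C, hC⟩ := hbound
  -- measurability of the two fixed factors on `[G] × [G]`
  have hφ₁m : AEStronglyMeasurable (fun x : 𝒢.automorphicQuotient × 𝒢.automorphicQuotient => φ₁ x.1) (μ.prod μ) :=
    hφ₁.aestronglyMeasurable.comp_fst
  have hφ₂m : AEStronglyMeasurable
      (fun x : 𝒢.automorphicQuotient × 𝒢.automorphicQuotient => starRingEnd ℂ (φ₂ x.2)) (μ.prod μ) :=
    Complex.continuous_conj.comp_aestronglyMeasurable hφ₂.aestronglyMeasurable.comp_snd
  -- dominated convergence
  unfold doublingPairing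
  refine tendsto_integral_filter_of_dominated_convergence
    (fun x : 𝒢.automorphicQuotient × 𝒢.automorphicQuotient => max C 0 * (‖φ₁ x.1‖ * ‖φ₂ x.2‖)) ?_ ?_
    (integrable_const_mul_norm_mul_norm 𝒢 μ hφ₁ hφ₂ (max C 0)) ?_
  · -- measurability, eventually
    filter_upwards [hmeas] with s hs
    exact (hs.mul hφ₁m).mul hφ₂m
  · -- the bound, eventually
    filter_upwards [hC] with s hs
    refine Eventually.of_forall fun x => ?_
    rw [norm_mul, norm_mul, Complex.norm_conj]
    have h0 : 0 ≤ ‖φ₁ x.1‖ * ‖φ₂ x.2‖ := mul_nonneg (norm_nonneg _) (norm_nonneg _)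
    calc ‖F s x‖ * ‖φ₁ x.1‖ * ‖φ₂ x.2‖ = ‖F s x‖ * (‖φ₁ x.1‖ * ‖φ₂ x.2‖) := mul_assoc _ _ _
      _ ≤ max C 0 * (‖φ₁ x.1‖ * ‖φ₂ x.2‖) :=
          mul_le_mul_of_nonneg_right ((hs x).trans (le_max_left _ _)) h0
  · -- the pointwise limit
    exact Eventually.of_forall fun x => ((hlim x).mul tendsto_const_nhds).mul tendsto_const_nhds

end Summit.HodgeConjecture.HodgeConjecture.Cruxes.HLiu418.K2LiuResiduePairingExchange

end
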